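import Mathlib
import Summits.NavierStokesRegularity.NavierStokesRegularity.Theorems.EulerZoomLiouvillePowerGaugeEulerLiouvilleFluxWindow
import Literature.Analysis.FluidPDE.SelfSimilarCollapseAnsatz
import HarnessLib

/-!
# OFF-RATE self-similar members of crux E — tools: time truncation of the gauges and the one-slice `A`-growth
# (crux `EulerZoomLiouville.PowerGaugeEulerLiouville` = stmt-NavierStokesRegularity-19832, line `birth` / line `logtime-breathers` T4;
# sequel file `…SelfSimilarOffRate` carries RATE RIGIDITY)

Route `EulerZoomLiouville` (NavierStokesRegularity); width seat ns-ezl-w4 g2.  An EXACTLY SELF-SIMILAR member of Seregin's `ρ`-class with an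
OFF-CLASS rate `g` (`u(τ) = selfSimilarCollapse g 0 W τ`, `g ≠ γ = 1/(2+ρ)`) is read, in the sequel, as a member-like object of the FICTITIOUS
class `ρ' = 1/g − 2` (so that `1/(2+ρ') = g` and the tree's rate-`1/(2+ρ')` dictionary applies verbatim).  The `ρ'`-gauges of the member itself
may fail at small scales (`a^{ρ'} > a^{ρ}` for `a < 1`, `ρ' < ρ`), but the large-scale profile data only need the gauges of the fields TRUNCATED to
a far past `τ < T₁ ≤ −1`, and those hold at EVERY scale: small parabolic windows at the origin do not meet the far past, and `a^{ρ'} ≤ a^{ρ}` for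
`a ≥ 1`.  This file:

* `OffRate.aestronglyMeasurable_uncurry_cut` — measurability of a time-truncated slab field `(τ, x) ↦ 𝟙_{τ < T₁} f(τ, x)`;
* `OffRate.cknE_cut_le` / `OffRate.cknE_cut_eq_zero` / `OffRate.gaugeE_cut` — the scaled dissipation of the truncated gradient: monotone, zero on
  windows `a² ≤ −T₁`, hence `a^{ρ'} E(a; H𝟙_{τ<T₁}) ≤ c` for ALL `a > 0` whenever `ρ' ≤ ρ`, `T₁ ≤ −1` and `a^{ρ} E(a; H) ≤ c`;
* `OffRate.cknD_cut_le` / `OffRate.cknD_cut_eq_zero` / `OffRate.gaugeD_cut` — the same for the pressure gauge (`a^{2ρ'}` vs `a^{2ρ}`);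
* `OffRate.slice_neg_one_eq_profile` — `u(−1) = W` for `u(τ) = selfSimilarCollapse g 0 W τ` (any rate `g`);
* `OffRate.profile_growth_ge_one` — the one-slice `A`-growth `∫_{B_L}‖W‖² ≤ 2c L^{1−2ρ}` for `L ≥ 1`;
* `OffRate.integral_ball_norm_sq_le` — the Bochner form of a ball bound;
* `OffRate.exponent_facts` — `ρ' = 1/g − 2`: `0 < ρ' < ρ`, `ρ' < 1`, `1/(2+ρ') = g` for `1/(2+ρ) < g < ½`, `0 < ρ < 1`.

WHAT THIS IS NOT: not NS, not E — helper lemmas `--supports` stmt-19832 for a stratum of the crux CLASS 19832 on the MODEL lattice. [folklore]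
-/

noncomputable section

-- flat `Theorems/<Route><Decl>…` files of one crux share the namespace of the crux (tree convention: `Summit.<S>.<S>.…`)
set_option linter.dupNamespace false

open MeasureTheory Set Filter Topology Metric Function TopologicalSpace
open scoped ENNReal NNReal

namespace Summit.NavierStokesRegularity.NavierStokesRegularity.Theorems.PowerGaugeEulerLiouville

open Literature.Analysis Literature.Analysis.FunctionSpaces Literature.Analysis.FluidPDE

namespace OffRate

/-! ### Time truncation of slab fields -/

/-- A time-truncated slab field `(τ, x) ↦ 𝟙_{τ < T₁} f(τ, x)` is a.e.-strongly measurable on the slab when `f` is (it is the indicator of the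
measurable set `{τ < T₁}` applied to `uncurry f`). [folklore] -/
theorem aestronglyMeasurable_uncurry_cut {F : Type*} [TopologicalSpace F] [Zero F] {f : ℝ → EuclideanSpace ℝ (Fin 3) → F}
    (hf : AEStronglyMeasurable (uncurry f) (volume.restrict (Iio (0 : ℝ) ×ˢ (univ : Set (EuclideanSpace ℝ (Fin 3))))))
    (T₁ : ℝ) :
    AEStronglyMeasurable (uncurry fun τ x => if τ < T₁ then f τ x else 0)
      (volume.restrict (Iio (0 : ℝ) ×ˢ (univ : Set (EuclideanSpace ℝ (Fin 3))))) := by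
  have h : (uncurry fun τ x => if τ < T₁ then f τ x else 0) =
      Set.indicator {z : ℝ × EuclideanSpace ℝ (Fin 3) | z.1 < T₁} (uncurry f) := by
    funext z
    rcases z with ⟨τ, x⟩
    simp only [uncurry_apply_pair, Set.indicator_apply, mem_setOf_eq]
  rw [h]
  exact hf.indicator (measurableSet_lt measurable_fst measurable_const)

/-! ### The scaled dissipation of a truncated gradient -/

/-- Truncation does not increase the scaled dissipation: `E(a; H𝟙_{τ<T₁}) ≤ E(a; H)`. [folklore] -/
theorem cknE_cut_le (a T₁ : ℝ)
    (H : ℝ → EuclideanSpace ℝ (Fin 3) → EuclideanSpace ℝ (Fin 3) →L[ℝ] EuclideanSpace ℝ (Fin 3)) :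
    cknE a (0 : ℝ × EuclideanSpace ℝ (Fin 3)) (fun τ x => if τ < T₁ then H τ x else 0) ≤
      cknE a (0 : ℝ × EuclideanSpace ℝ (Fin 3)) H := by
  unfold cknE
  refine mul_le_mul_right (lintegral_mono fun q => ?_) _
  by_cases h : q.1 < T₁
  · simp [h]
  · simp [h, frobeniusNormSq_zero]

/-- On windows that do not reach the far past the truncated dissipation vanishes: `a² ≤ −T₁ ⇒ E(a; H𝟙_{τ<T₁}) = 0`
(the parabolic cylinder `Q_a(0,0) = (−a², 0) × B_a` lies in `{τ ≥ T₁}`). [folklore] -/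
theorem cknE_cut_eq_zero {a T₁ : ℝ} (ha : a ^ 2 ≤ -T₁)
    (H : ℝ → EuclideanSpace ℝ (Fin 3) → EuclideanSpace ℝ (Fin 3) →L[ℝ] EuclideanSpace ℝ (Fin 3)) :
    cknE a (0 : ℝ × EuclideanSpace ℝ (Fin 3)) (fun τ x => if τ < T₁ then H τ x else 0) = 0 := by
  unfold cknE
  have h0 : ∫⁻ q in parabolicCylinder a (0 : ℝ × EuclideanSpace ℝ (Fin 3)),
      ENNReal.ofReal (frobeniusNormSq ((fun τ x => if τ < T₁ then H τ x else 0) q.1 q.2)) = 0 := by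
    refine le_antisymm ?_ bot_le
    calc ∫⁻ q in parabolicCylinder a (0 : ℝ × EuclideanSpace ℝ (Fin 3)),
          ENNReal.ofReal (frobeniusNormSq ((fun τ x => if τ < T₁ then H τ x else 0) q.1 q.2))
        ≤ ∫⁻ _ in parabolicCylinder a (0 : ℝ × EuclideanSpace ℝ (Fin 3)), (0 : ℝ≥0∞) :=
          setLIntegral_mono measurable_const fun q hq => by
            simp only [parabolicCylinder, mem_prod, mem_Ioo, Prod.fst_zero, Prod.snd_zero, zero_sub] at hq
            have hnot : ¬ q.1 < T₁ := by linarith [hq.1.1]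
            simp [hnot, frobeniusNormSq_zero]
      _ = 0 := lintegral_zero
  rw [h0, mul_zero]

/-- **The `ρ'`-dissipation gauge of the truncated gradient, at every scale.**  If `a^{ρ} E(a; H) ≤ c` for all `a > 0`, `ρ' ≤ ρ` and `T₁ ≤ −1`,
then `a^{ρ'} E(a; H𝟙_{τ<T₁}) ≤ c` for ALL `a > 0` (`a ≤ 1`: the window misses the far past; `a > 1`: `a^{ρ'} ≤ a^{ρ}` and monotonicity).
[folklore] -/
theorem gaugeE_cut {ρ ρ' : ℝ} (hρ' : ρ' ≤ ρ) {c : ℝ≥0}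
    {H : ℝ → EuclideanSpace ℝ (Fin 3) → EuclideanSpace ℝ (Fin 3) →L[ℝ] EuclideanSpace ℝ (Fin 3)}
    (hE : ∀ a : ℝ, 0 < a →
      ENNReal.ofReal (a ^ ρ) * cknE a (0 : ℝ × EuclideanSpace ℝ (Fin 3)) H ≤ (c : ℝ≥0∞))
    {T₁ : ℝ} (hT₁ : T₁ ≤ -1) :
    ∀ a : ℝ, 0 < a →
      ENNReal.ofReal (a ^ ρ') * cknE a (0 : ℝ × EuclideanSpace ℝ (Fin 3)) (fun τ x => if τ < T₁ then H τ x else 0) ≤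
        (c : ℝ≥0∞) := by
  intro a ha
  by_cases ha1 : a ≤ 1
  · have hsq : a ^ 2 ≤ -T₁ := by nlinarith
    rw [cknE_cut_eq_zero hsq, mul_zero]
    exact bot_le
  · have ha1' : 1 ≤ a := le_of_lt (not_le.1 ha1)
    calc ENNReal.ofReal (a ^ ρ') * cknE a (0 : ℝ × EuclideanSpace ℝ (Fin 3)) (fun τ x => if τ < T₁ then H τ x else 0)
        ≤ ENNReal.ofReal (a ^ ρ) * cknE a (0 : ℝ × EuclideanSpace ℝ (Fin 3)) H :=
          mul_le_mul' (ENNReal.ofReal_le_ofReal (Real.rpow_le_rpow_of_exponent_le ha1' hρ')) (cknE_cut_le a T₁ H)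
      _ ≤ (c : ℝ≥0∞) := hE a ha

/-! ### The scaled pressure gauge of a truncated pressure -/

/-- Truncation does not increase the scaled pressure quantity: `D(a; p𝟙_{τ<T₁}) ≤ D(a; p)`. [folklore] -/
theorem cknD_cut_le (a T₁ : ℝ) (p : ℝ → EuclideanSpace ℝ (Fin 3) → ℝ) :
    cknD a (0 : ℝ × EuclideanSpace ℝ (Fin 3)) (fun τ x => if τ < T₁ then p τ x else 0) ≤
      cknD a (0 : ℝ × EuclideanSpace ℝ (Fin 3)) p := by
  unfold cknD
  refine mul_le_mul_right (lintegral_mono fun q => ?_) _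
  by_cases h : q.1 < T₁
  · simp [h]
  · simp [h]

/-- `a² ≤ −T₁ ⇒ D(a; p𝟙_{τ<T₁}) = 0`. [folklore] -/
theorem cknD_cut_eq_zero {a T₁ : ℝ} (ha : a ^ 2 ≤ -T₁) (p : ℝ → EuclideanSpace ℝ (Fin 3) → ℝ) :
    cknD a (0 : ℝ × EuclideanSpace ℝ (Fin 3)) (fun τ x => if τ < T₁ then p τ x else 0) = 0 := by
  unfold cknD
  have h0 : ∫⁻ q in parabolicCylinder a (0 : ℝ × EuclideanSpace ℝ (Fin 3)),
      ‖(fun τ x => if τ < T₁ then p τ x else 0) q.1 q.2‖ₑ ^ (3 / 2 : ℝ) = 0 := by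
    refine le_antisymm ?_ bot_le
    calc ∫⁻ q in parabolicCylinder a (0 : ℝ × EuclideanSpace ℝ (Fin 3)),
          ‖(fun τ x => if τ < T₁ then p τ x else 0) q.1 q.2‖ₑ ^ (3 / 2 : ℝ)
        ≤ ∫⁻ _ in parabolicCylinder a (0 : ℝ × EuclideanSpace ℝ (Fin 3)), (0 : ℝ≥0∞) :=
          setLIntegral_mono measurable_const fun q hq => by
            simp only [parabolicCylinder, mem_prod, mem_Ioo, Prod.fst_zero, Prod.snd_zero, zero_sub] at hq
            have hnot : ¬ q.1 < T₁ := by linarith [hq.1.1]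
            simp [hnot, ENNReal.zero_rpow_of_pos]
      _ = 0 := lintegral_zero
  rw [h0, mul_zero]

/-- **The `ρ'`-pressure gauge of the truncated pressure, at every scale.**  If `a^{2ρ} D(a; p) ≤ c` for all `a > 0`, `ρ' ≤ ρ` and `T₁ ≤ −1`, then
`a^{2ρ'} D(a; p𝟙_{τ<T₁}) ≤ c` for all `a > 0`. [folklore] -/
theorem gaugeD_cut {ρ ρ' : ℝ} (hρ' : ρ' ≤ ρ) {c : ℝ≥0} {p : ℝ → EuclideanSpace ℝ (Fin 3) → ℝ}
    (hD : ∀ a : ℝ, 0 < a →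
      ENNReal.ofReal (a ^ (2 * ρ)) * cknD a (0 : ℝ × EuclideanSpace ℝ (Fin 3)) p ≤ (c : ℝ≥0∞))
    {T₁ : ℝ} (hT₁ : T₁ ≤ -1) :
    ∀ a : ℝ, 0 < a →
      ENNReal.ofReal (a ^ (2 * ρ')) * cknD a (0 : ℝ × EuclideanSpace ℝ (Fin 3)) (fun τ x => if τ < T₁ then p τ x else 0) ≤
        (c : ℝ≥0∞) := by
  intro a ha
  by_cases ha1 : a ≤ 1
  · have hsq : a ^ 2 ≤ -T₁ := by nlinarith
    rw [cknD_cut_eq_zero hsq, mul_zero]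
    exact bot_le
  · have ha1' : 1 ≤ a := le_of_lt (not_le.1 ha1)
    calc ENNReal.ofReal (a ^ (2 * ρ')) * cknD a (0 : ℝ × EuclideanSpace ℝ (Fin 3)) (fun τ x => if τ < T₁ then p τ x else 0)
        ≤ ENNReal.ofReal (a ^ (2 * ρ)) * cknD a (0 : ℝ × EuclideanSpace ℝ (Fin 3)) p :=
          mul_le_mul' (ENNReal.ofReal_le_ofReal (Real.rpow_le_rpow_of_exponent_le ha1' (by linarith)))
            (cknD_cut_le a T₁ p)
      _ ≤ (c : ℝ≥0∞) := hD a ha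

/-! ### The one-slice `A`-growth of an exactly self-similar member of any rate -/

/-- For `u(τ) = selfSimilarCollapse g 0 W τ` (`τ < 0`), the slice at `τ = −1` IS the profile: `u(−1) = W` (any rate `g`). [folklore] -/
theorem slice_neg_one_eq_profile {g : ℝ} {u : ℝ → EuclideanSpace ℝ (Fin 3) → EuclideanSpace ℝ (Fin 3)}
    {W : EuclideanSpace ℝ (Fin 3) → EuclideanSpace ℝ (Fin 3)}
    (hu : ∀ τ : ℝ, τ < 0 → u τ = selfSimilarCollapse g 0 W τ) : u (-1) = W := by
  rw [hu (-1) (by norm_num)]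
  funext x
  simp [selfSimilarCollapse_apply]

/-- **One-slice `A`-growth.**  If `u(τ) = selfSimilarCollapse g 0 W τ` for `τ < 0` (ANY rate `g`) and `a^{2ρ} A(a; 0) ≤ c` for all `a > 0`
(`ρ ≥ 0`), then `∫_{B_L}‖W‖² ≤ 2c L^{1−2ρ}` for every `L ≥ 1` (the slice `τ = −1` on the ball `B_{2L}`, admissible since `4L² > 1`;
`(2L)^{1−2ρ} ≤ 2 L^{1−2ρ}`). [folklore] -/
theorem profile_growth_ge_one {ρ : ℝ} (hρ : 0 ≤ ρ) {c : ℝ≥0} {g : ℝ}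
    {u : ℝ → EuclideanSpace ℝ (Fin 3) → EuclideanSpace ℝ (Fin 3)} {W : EuclideanSpace ℝ (Fin 3) → EuclideanSpace ℝ (Fin 3)}
    (hA : ∀ a : ℝ, 0 < a → ENNReal.ofReal (a ^ (2 * ρ)) *
      cknA a (0 : ℝ × EuclideanSpace ℝ (Fin 3)) u ≤ (c : ℝ≥0∞))
    (hu : ∀ τ : ℝ, τ < 0 → u τ = selfSimilarCollapse g 0 W τ) :
    ∀ L : ℝ, 1 ≤ L → ∫⁻ y in ball (0 : EuclideanSpace ℝ (Fin 3)) L, ‖W y‖ₑ ^ 2 ≤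
      ENNReal.ofReal (2 * c) * ENNReal.ofReal (L ^ (1 - 2 * ρ)) := by
  intro L hL
  have hL0 : 0 < L := by linarith
  have hS := hasScaledLocalEnergyBound_of_gaugeA hA
  have hmem : (-1 : ℝ) ∈ Ioo (-((2 * L) ^ 2)) 0 := ⟨by nlinarith, by norm_num⟩
  have h := hS (2 * L) (by positivity) (-1) hmem
  rw [slice_neg_one_eq_profile hu] at h
  calc ∫⁻ y in ball (0 : EuclideanSpace ℝ (Fin 3)) L, ‖W y‖ₑ ^ 2
      ≤ ∫⁻ y in ball (0 : EuclideanSpace ℝ (Fin 3)) (2 * L), ‖W y‖ₑ ^ 2 := lintegral_mono_set (ball_subset_ball (by linarith))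
    _ ≤ ENNReal.ofReal (c * (2 * L) ^ (1 - 2 * ρ)) := h
    _ ≤ ENNReal.ofReal (2 * c) * ENNReal.ofReal (L ^ (1 - 2 * ρ)) := by
        rw [← ENNReal.ofReal_mul (by positivity)]
        refine ENNReal.ofReal_le_ofReal ?_
        rw [Real.mul_rpow (by norm_num) hL0.le]
        have h2 : (2 : ℝ) ^ (1 - 2 * ρ) ≤ 2 := by
          conv_rhs => rw [← Real.rpow_one 2]
          exact Real.rpow_le_rpow_of_exponent_le one_le_two (by linarith)
        have hLp : 0 ≤ L ^ (1 - 2 * ρ) := Real.rpow_nonneg hL0.le _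
        have hc0 : (0 : ℝ) ≤ c := c.2
        nlinarith [mul_nonneg hc0 hLp]

/-- The Bochner form of a ball bound: `∫⁻_{B_L}‖W‖ₑ² ≤ B` (`B ≥ 0`) gives `∫_{B_L}‖W‖² ≤ B`. [folklore] -/
theorem integral_ball_norm_sq_le {W : EuclideanSpace ℝ (Fin 3) → EuclideanSpace ℝ (Fin 3)}
    (hWm : AEStronglyMeasurable W volume) {B : ℝ} (hB : 0 ≤ B) {L : ℝ}
    (h : ∫⁻ y in ball (0 : EuclideanSpace ℝ (Fin 3)) L, ‖W y‖ₑ ^ 2 ≤ ENNReal.ofReal B) :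
    ∫ y in ball (0 : EuclideanSpace ℝ (Fin 3)) L, ‖W y‖ ^ 2 ≤ B := by
  rw [integral_eq_lintegral_of_nonneg_ae (Eventually.of_forall fun y => sq_nonneg _)
    (hWm.restrict.norm.pow 2)]
  have he : ∀ y : EuclideanSpace ℝ (Fin 3), ENNReal.ofReal (‖W y‖ ^ 2) = ‖W y‖ₑ ^ 2 := fun y => by
    rw [← ofReal_norm, ENNReal.ofReal_pow (norm_nonneg _)]
  simp_rw [he]
  exact ENNReal.toReal_le_of_le_ofReal hB h

/-! ### The fictitious exponent `ρ' = 1/g − 2` -/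

/-- For `0 < ρ < 1` and `1/(2+ρ) < g < ½`: `ρ' = 1/g − 2` satisfies `0 < ρ'`, `ρ' < ρ`, `ρ' < 1`, and `1/(2+ρ') = g`. [folklore] -/
theorem exponent_facts {ρ g : ℝ} (hρ : 0 < ρ) (hρ1 : ρ < 1) (hg1 : 1 / (2 + ρ) < g) (hg2 : g < 1 / 2) :
    0 < 1 / g - 2 ∧ 1 / g - 2 < ρ ∧ 1 / g - 2 < 1 ∧ 1 / (2 + (1 / g - 2)) = g := by
  have h2ρ : (0 : ℝ) < 2 + ρ := by linarith
  have hg0 : 0 < g := lt_trans (one_div_pos.2 h2ρ) hg1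
  have hprod : 1 < g * (2 + ρ) := (div_lt_iff₀ h2ρ).1 hg1
  have hginv : 1 / g = g⁻¹ := one_div g
  refine ⟨?_, ?_, ?_, ?_⟩
  · rw [sub_pos, lt_div_iff₀ hg0]; linarith
  · rw [sub_lt_iff_lt_add, div_lt_iff₀ hg0]; linarith
  · rw [sub_lt_iff_lt_add, div_lt_iff₀ hg0]; nlinarith
  · rw [show (2 : ℝ) + (1 / g - 2) = 1 / g by ring, one_div_one_div]

end OffRate

end Summit.NavierStokesRegularity.NavierStokesRegularity.Theorems.PowerGaugeEulerLiouville

end
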